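import Summits.KontsevichZagierPeriods.KontsevichZagierPeriods.Theses.HurwitzMicroSectors
import Literature.NumberTheory.Transcendental.BoxIntegralHurwitzWeightTwo
import Literature.NumberTheory.Transcendental.BoxCoordinatePowerMap
import Literature.NumberTheory.Transcendental.KZLogCalculusProofs
import Literature.NumberTheory.Transcendental.KZUnfoldedStokesProofs

/-! First lemmas of crux-ideate round 1, ideator 3 (cards numerator-lattice, conductor-descent, jacobian-tail): discharge of the cheapest falsifier of card jacobian-tail — the Φ_{k+1} witness
elaborates and closes against `KZ.changeOfVariablesRel` (MonomialAbsorption PROVED), and the same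
for the Φ₂ template of card numerator-lattice / conductor-descent (TemplateTwoIsMove PROVED?). -/

set_option linter.dupNamespace false
open Polynomial Set MeasureTheory
open Literature.NumberTheory.Transcendental

namespace Summit.KontsevichZagierPeriods.KontsevichZagierPeriods.Cruxes.SectorTwoSix.FirstLemmasR1I3

abbrev box : Set (Fin 2 → ℝ) := {x | ∀ i, x i ∈ Set.Ioo (0:ℝ) 1}

theorem box_eq_unitCube : box = KZ.unitCube 2 := rfl

theorem isSemialgebraicMapOn_coordPow_box (m : ℕ) :
    IsSemialgebraicMapOn ℚ box (BoxIntegral.coordPow (n := 2) m) :=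
  (isSemialgebraicMapOn_aeval (R := ℝ) (KZ.isSemialgebraic_unitCube 2)
    (fun j => (MvPolynomial.X j) ^ m)).congr (fun x _ => by
      funext j; simp [BoxIntegral.coordPow])

/-- Card jacobian-tail, first lemma, PROVED: `[B, c (k+1)² tᵏ] − [B, c]` is one CoV move. -/
theorem monomialAbsorption (k : ℕ) (c : ℚ) (r r' : KZ.IntegralRep 2) (hr : r.domain = box)
    (hr' : r'.domain = box)
    (hf : EqOn r.integrand (fun x => (c : ℝ) * ((k : ℝ) + 1) ^ 2 * (x 0 * x 1) ^ k) r.domain)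
    (hf' : EqOn r'.integrand (fun _ => (c : ℝ)) r'.domain) :
    KZ.of r - KZ.of r' ∈ KZ.changeOfVariablesRel := by
  have hm : k + 1 ≠ 0 := Nat.succ_ne_zero k
  refine ⟨2, r, r', BoxIntegral.coordPow (k + 1), BoxIntegral.coordPowDeriv (k + 1),
    ?_, ?_, ?_, ?_, ?_, rfl⟩
  · rw [hr]; exact isSemialgebraicMapOn_coordPow_box (k + 1)
  · intro x _; exact BoxIntegral.hasFDerivWithinAt_coordPow (k + 1) r.domain x
  · rw [hr]; exact BoxIntegral.injOn_coordPow_box hm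
  · rw [hr, hr']; exact (BoxIntegral.image_coordPow_box hm).symm
  · intro x hx
    have hxb : ∀ i, x i ∈ Set.Ioo (0:ℝ) 1 := by rw [hr] at hx; exact hx
    have hΦx : BoxIntegral.coordPow (k + 1) x ∈ r'.domain := by
      rw [hr']; exact BoxIntegral.mapsTo_coordPow_box hm hxb
    rw [hf hx, hf' hΦx, BoxIntegral.abs_det_coordPowDeriv hm hxb]
    simp [Fin.prod_univ_two, mul_pow]
    ring

/-- The pointwise identity behind the Φ₂ template: `4t·G(t²)/(1−t⁶) = [G(s)(1+s³)/(1−s⁶)]|_{s=t²} · 4t`. -/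
theorem templateTwo_pointwise (t : ℝ) (G : ℚ[X]) (h1 : (1:ℝ) - t ^ 6 ≠ 0)
    (h2 : (1:ℝ) - t ^ 12 ≠ 0) :
    (aeval t) (4 * X * G.comp (X ^ 2)) / (1 - t ^ 6)
      = (aeval (t ^ 2)) (G * (1 + X ^ 3)) / (1 - (t ^ 2) ^ 6) * (2 ^ 2 * t) := by
  simp only [map_mul, map_add, map_one, map_pow, aeval_X, aeval_comp, map_ofNat]
  have h3 : (1:ℝ) + t ^ 6 ≠ 0 := by positivity
  have e12 : (1:ℝ) - t ^ 12 = (1 - t ^ 6) * (1 + t ^ 6) := by ring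
  have e1 : t ^ (2 * 3) = t ^ 6 := by norm_num
  have e2 : (t ^ 2) ^ 6 = t ^ 12 := by ring
  rw [e1, e2, e12]
  field_simp
  ring

/-- Card numerator-lattice / conductor-descent, first lemma, PROVED: the Φ₂ template is one CoV
move between the level-6 numerators `4t·G(t²)` and `G(t)(1+t³)` (= `G/(1−t³)`). -/
theorem templateTwoIsMove (G : ℚ[X]) (r r' : KZ.IntegralRep 2) (hr : r.domain = box)
    (hr' : r'.domain = box)
    (hf : EqOn r.integrand
      (fun x => aeval (x 0 * x 1) (4 * X * G.comp (X ^ 2)) / (1 - (x 0 * x 1) ^ 6)) r.domain)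
    (hf' : EqOn r'.integrand
      (fun x => aeval (x 0 * x 1) (G * (1 + X ^ 3)) / (1 - (x 0 * x 1) ^ 6)) r'.domain) :
    KZ.of r - KZ.of r' ∈ KZ.changeOfVariablesRel := by
  have hm : (2 : ℕ) ≠ 0 := two_ne_zero
  refine ⟨2, r, r', BoxIntegral.coordPow 2, BoxIntegral.coordPowDeriv 2, ?_, ?_, ?_, ?_, ?_, rfl⟩
  · rw [hr]; exact isSemialgebraicMapOn_coordPow_box 2
  · intro x _; exact BoxIntegral.hasFDerivWithinAt_coordPow 2 r.domain x
  · rw [hr]; exact BoxIntegral.injOn_coordPow_box hm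
  · rw [hr, hr']; exact (BoxIntegral.image_coordPow_box hm).symm
  · intro x hx
    have hxb : ∀ i, x i ∈ Set.Ioo (0:ℝ) 1 := by rw [hr] at hx; exact hx
    have hΦx : BoxIntegral.coordPow 2 x ∈ r'.domain := by
      rw [hr']; exact BoxIntegral.mapsTo_coordPow_box hm hxb
    rw [hf hx, hf' hΦx, BoxIntegral.abs_det_coordPowDeriv hm hxb]
    have ht := BoxIntegral.mul_mem_Ioo_of_mem_box hxb
    have h1 : (1 : ℝ) - (x 0 * x 1) ^ 6 ≠ 0 := by
      have : (x 0 * x 1) ^ 6 < 1 := pow_lt_one₀ ht.1.le ht.2 (by norm_num)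
      linarith
    have h2 : (1 : ℝ) - (x 0 * x 1) ^ 12 ≠ 0 := by
      have : (x 0 * x 1) ^ 12 < 1 := pow_lt_one₀ ht.1.le ht.2 (by norm_num)
      linarith
    have key := templateTwo_pointwise (x 0 * x 1) G h1 h2
    simp only [BoxIntegral.coordPow_apply, Fin.prod_univ_two, Nat.cast_ofNat]
    have e : x 0 ^ 2 * x 1 ^ 2 = (x 0 * x 1) ^ 2 := by ring
    have e' : x 0 ^ (2 - 1) * x 1 ^ (2 - 1) = x 0 * x 1 := by norm_num
    rw [e, e', key]

end Summit.KontsevichZagierPeriods.KontsevichZagierPeriods.Cruxes.SectorTwoSix.FirstLemmasR1I3
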